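import Literature.NumberTheory.Weil1964.LocalWeilIndexQuadraticForm
import HarnessLib

/-!
# The Weil index of a possibly degenerate quadratic form: the index of the non-degenerate quotient

Topic `NumberTheory/Weil1964`; namespace `Literature.NumberTheory.Weil1964`. KERNEL mathematics only (plumbing
definitions with bodies + theorems; no named fact, no `axiom`, no `sorry`). Sequel of `LocalWeilIndexQuadraticForm.lean`.

A quadratic form `f` on `X = F^ι` (`F` a non-archimedean local field of characteristic `≠ 2`) which is degenerate still
has a Weil index in the sense used by Rao's cocycle formula and Kudla's splitting: `f` induces a NON-degenerate form `f̄`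
on `X / rad(f)` and one sets `γ(f) := γ(f̄)` ([Rangarao1993] Appendix Thm A.3: a degenerate character of the second degree,
trivial on `Γ = rad`, induces a non-degenerate one on `Γ*ρ⁻¹/Γ`, "and the Weil index of `f` is equal to the Weil index
of" the induced character). In coordinates: if `f = (Σ cᵢ xᵢ²) ∘ A` with `A ∈ GL(F^ι)` and ARBITRARY `cᵢ` (zeros allowed —
every form diagonalises so in characteristic `≠ 2`), then `f̄ ≅ Σ_{cᵢ ≠ 0} cᵢ xᵢ²` and

  `γ(f) = Π_{i : cᵢ ≠ 0} γ(cᵢ xᵢ²)`   (`weilIndexDiag ψ μ c`).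

The content of this file is that this is WELL DEFINED:

* §1 algebra of diagonal forms with zeros: the polar form `polar(Σ cᵢxᵢ²)(u, w) = Σ 2cᵢuᵢwᵢ`, extension by zero /
  restriction to the support `S(c) = {i | cᵢ ≠ 0}`, and the TRANSFER MAP: an equivalence `Σ cᵢ xᵢ² = (Σ c'ⱼ xⱼ²) ∘ E`
  induces an injective linear map `F^{S(c)} → F^{S(c')}` intertwining the non-degenerate parts — hence (both ways)
  `|S(c)| = |S(c')|` (the rank) and an EQUIVALENCE of the non-degenerate parts (the isometry `X/rad f ≅ X'/rad f'`);
* §2 **independence**: `Π_{cᵢ≠0} γ(cᵢ) = Π_{c'ⱼ≠0} γ(c'ⱼ)` whenever `Σ cᵢ xᵢ²` and `Σ c'ⱼ xⱼ²` are equivalent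
  (`weilIndexDiag_eq_of_equiv`, from `weilIndexQF_eq_prod_weilIndex` applied to two diagonalisations of the common
  non-degenerate part);
* §3 the Weil index `weilIndexQF' ψ μ f` of an ARBITRARY quadratic form on `F^ι` (via any diagonalisation): equal to
  `Π_{cᵢ≠0} γ(cᵢ)` for EVERY diagonalisation, to `weilIndexQF ψ μ f` when `f` is non-degenerate, invariant under `GL(F^ι)`,
  of absolute value `1`, and `= 1` for the zero form.

## References

* [Rangarao1993] R. Ranga Rao, *On some explicit formulas in the theory of Weil representation*, Pacific J. Math. 157
  (1993), Appendix Thm A.2 (1), Thm A.3 (pp. 366–367).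
* [Weil1964] A. Weil, *Sur certains groupes d'opérateurs unitaires*, Acta Math. 111 (1964), Chap. II n° 23, n° 25 p. 173.
-/

set_option autoImplicit false

noncomputable section

open MeasureTheory QuadraticMap
open scoped NNReal Classical

namespace Literature.NumberTheory.Weil1964

/-! ## §1 Diagonal forms with zeros: polar form, support, transfer map, diagonalisation -/

section Algebra

variable {F : Type*} [Field F] {ι : Type*}

/-- the polar (associated symmetric bilinear, `×2`) form of `Σ cᵢ xᵢ²`: `f(u+w) - f(u) - f(w) = Σ 2 cᵢ uᵢ wᵢ`.
[cite: Weil1964, Chap. II n° 23, p. 172] -/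
theorem polar_weightedSumSquares [Fintype ι] (c u w : ι → F) :
    polar (weightedSumSquares F c) u w = ∑ i, 2 * c i * u i * w i := by
  simp only [polar, weightedSumSquares_apply, smul_eq_mul, Pi.add_apply]
  rw [← Finset.sum_sub_distrib, ← Finset.sum_sub_distrib]
  exact Finset.sum_congr rfl fun i _ => by ring

/-- the polar form against a basis vector: `polar(Σ cᵢxᵢ²)(u, eᵢ) = 2 cᵢ uᵢ`. [cite: Weil1964, Chap. II n° 23, p. 172] -/
theorem polar_weightedSumSquares_single [Fintype ι] (c u : ι → F) (i : ι) :
    polar (weightedSumSquares F c) u (Pi.single i 1) = 2 * c i * u i := by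
  rw [polar_weightedSumSquares, Finset.sum_eq_single i]
  · rw [Pi.single_eq_same, mul_one]
  · intro j _ hji; rw [Pi.single_eq_of_ne hji, mul_zero]
  · intro h; exact absurd (Finset.mem_univ i) h

/-- an equivalence of diagonal forms transports the polar forms: if `Σ cᵢxᵢ² = (Σ c'ⱼxⱼ²) ∘ E` then
`polar_c(u, w) = polar_{c'}(E u, E w)`. [cite: Weil1964, Chap. II n° 25, p. 173] -/
theorem polar_eq_polar_of_comp [Fintype ι] {c c' : ι → F} (E : (ι → F) →ₗ[F] (ι → F))
    (hE : ∀ x, weightedSumSquares F c x = weightedSumSquares F c' (E x)) (u w : ι → F) :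
    polar (weightedSumSquares F c) u w = polar (weightedSumSquares F c') (E u) (E w) := by
  simp only [polar, hE, map_add]

variable (c : ι → F)

/-- the SUPPORT `S(c) = {i | cᵢ ≠ 0}` of the coefficient family: the coordinates of the non-degenerate part of `Σ cᵢ xᵢ²`
(the complement indexes the radical). [cite: Rangarao1993, Appendix Thm A.3, p. 367] -/
abbrev coeffSupport : Type _ := {i : ι // c i ≠ 0}

/-- **extension by zero** `F^{S(c)} → F^ι` (a section of the quotient map `X → X/rad`). [cite: Rangarao1993, Appendix Thm A.3, p. 367] -/
def extendByZero : (coeffSupport c → F) →ₗ[F] (ι → F) where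
  toFun x i := if h : c i ≠ 0 then x ⟨i, h⟩ else 0
  map_add' x y := by
    funext i
    by_cases h : c i ≠ 0
    · simp only [dif_pos h, Pi.add_apply]
    · simp only [dif_neg h, Pi.add_apply, add_zero]
  map_smul' a x := by
    funext i
    by_cases h : c i ≠ 0
    · simp only [dif_pos h, Pi.smul_apply, smul_eq_mul, RingHom.id_apply]
    · simp only [dif_neg h, Pi.smul_apply, smul_eq_mul, mul_zero, RingHom.id_apply]

/-- unfolding of the extension by zero. [cite: Rangarao1993, Appendix Thm A.3, p. 367] -/
theorem extendByZero_apply (x : coeffSupport c → F) (i : ι) :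
    extendByZero c x i = if h : c i ≠ 0 then x ⟨i, h⟩ else 0 := rfl

/-- on the support the extension by zero is the identity. [cite: Rangarao1993, Appendix Thm A.3, p. 367] -/
theorem extendByZero_apply_coe (x : coeffSupport c → F) (i : coeffSupport c) : extendByZero c x i = x i := by
  rw [extendByZero_apply, dif_pos i.2]

/-- **restriction to the support** `F^ι → F^{S(c)}` (the quotient map `X → X/rad` in coordinates).
[cite: Rangarao1993, Appendix Thm A.3, p. 367] -/
def restrictSupport : (ι → F) →ₗ[F] (coeffSupport c → F) := LinearMap.funLeft F F Subtype.val

/-- unfolding of the restriction. [cite: Rangarao1993, Appendix Thm A.3, p. 367] -/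
theorem restrictSupport_apply (y : ι → F) (i : coeffSupport c) : restrictSupport c y i = y i := rfl

variable [Fintype ι]

/-- the diagonal form only sees the support coordinates: `Σ cᵢ yᵢ² = Σ_{i ∈ S(c)} cᵢ yᵢ²` (the NON-DEGENERATE PART
`Σ_{i ∈ S(c)} cᵢ xᵢ²`, a form on `F^{S(c)}` with non-zero coefficients, evaluated at the restriction).
[cite: Rangarao1993, Appendix Thm A.3, p. 367] -/
theorem weightedSumSquares_eq_restrict (y : ι → F) :
    weightedSumSquares F c y = weightedSumSquares F (fun i : coeffSupport c => c i) (restrictSupport c y) := by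
  rw [weightedSumSquares_apply, weightedSumSquares_apply]
  simp only [smul_eq_mul, restrictSupport_apply]
  rw [← Finset.sum_subtype (Finset.univ.filter fun i => c i ≠ 0) (fun i => by simp) (fun i => c i * (y i * y i)),
    Finset.sum_filter]
  refine Finset.sum_congr rfl fun i _ => ?_
  by_cases h : c i ≠ 0
  · rw [if_pos h]
  · rw [if_neg h, not_not.1 h, zero_mul]

/-- `Σ cᵢ (ext x)ᵢ² = Σ_{i ∈ S(c)} cᵢ xᵢ²`. [cite: Rangarao1993, Appendix Thm A.3, p. 367] -/
theorem weightedSumSquares_extendByZero (x : coeffSupport c → F) :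
    weightedSumSquares F c (extendByZero c x) = weightedSumSquares F (fun i : coeffSupport c => c i) x := by
  rw [weightedSumSquares_eq_restrict]
  congr 1
  funext i
  rw [restrictSupport_apply, extendByZero_apply_coe]

variable {c} {c' : ι → F}

/-- the **transfer map** of an equivalence `Σ cᵢxᵢ² = (Σ c'ⱼxⱼ²) ∘ E`: `F^{S(c)} → F^{S(c')}`, `x ↦ (E(ext x))|_{S(c')}`
(the induced map `X/rad f → X'/rad f'` in coordinates). [cite: Rangarao1993, Appendix Thm A.3, p. 367] -/
def transferMap (c c' : ι → F) (E : (ι → F) →ₗ[F] (ι → F)) : (coeffSupport c → F) →ₗ[F] (coeffSupport c' → F) :=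
  (restrictSupport c').comp (E.comp (extendByZero c))

omit [Fintype ι] in
/-- unfolding. [cite: Rangarao1993, Appendix Thm A.3, p. 367] -/
theorem transferMap_apply (E : (ι → F) →ₗ[F] (ι → F)) (x : coeffSupport c → F) (j : coeffSupport c') :
    transferMap c c' E x j = E (extendByZero c x) j := rfl

/-- **the transfer map intertwines the non-degenerate parts**: `f'_{S'}(T x) = f_S(x)`.
[cite: Rangarao1993, Appendix Thm A.3, p. 367] -/
theorem weightedSumSquares_transferMap (E : (ι → F) →ₗ[F] (ι → F))
    (hE : ∀ x, weightedSumSquares F c x = weightedSumSquares F c' (E x)) (x : coeffSupport c → F) :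
    weightedSumSquares F (fun j : coeffSupport c' => c' j) (transferMap c c' E x) =
      weightedSumSquares F (fun i : coeffSupport c => c i) x := by
  rw [← weightedSumSquares_extendByZero c x, hE, weightedSumSquares_eq_restrict c']
  rfl

/-- **the transfer map is injective** (characteristic `≠ 2`): if `E(ext x)` vanishes on the support of `c'` it lies in the
radical of `Σ c'ⱼxⱼ²`, so `ext x` lies in the radical of `Σ cᵢxᵢ²` (the polar forms correspond under `E`), whose support
coordinates vanish. [cite: Rangarao1993, Appendix Thm A.3, p. 367] -/
theorem transferMap_injective (htwo : (2 : F) ≠ 0) (E : (ι → F) →ₗ[F] (ι → F))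
    (hE : ∀ x, weightedSumSquares F c x = weightedSumSquares F c' (E x)) :
    Function.Injective (transferMap c c' E) := by
  refine (injective_iff_map_eq_zero _).2 fun x hx => ?_
  -- `E (ext x)` is orthogonal to everything for `polar_{c'}`
  have hrad : ∀ w : ι → F, polar (weightedSumSquares F c') (E (extendByZero c x)) w = 0 := by
    intro w
    rw [polar_weightedSumSquares]
    refine Finset.sum_eq_zero fun j _ => ?_
    by_cases hj : c' j = 0
    · rw [hj, mul_zero, zero_mul, zero_mul]
    · have h0 : E (extendByZero c x) j = 0 := by
        have := congrFun hx ⟨j, hj⟩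
        rwa [transferMap_apply] at this
      rw [h0, mul_zero, zero_mul]
  -- hence `ext x` is orthogonal to `eᵢ` for `polar_c`, `i ∈ S(c)`: `2 cᵢ xᵢ = 0`
  funext i
  have h1 : polar (weightedSumSquares F c) (extendByZero c x) (Pi.single (i : ι) 1) = 0 := by
    rw [polar_eq_polar_of_comp E hE, hrad]
  have h2 : 2 * c i * x i = 0 := by
    rw [polar_weightedSumSquares_single, extendByZero_apply_coe] at h1
    exact h1
  rcases mul_eq_zero.1 h2 with h3 | h3
  · rcases mul_eq_zero.1 h3 with h4 | h4
    · exact absurd h4 htwo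
    · exact absurd h4 i.2
  · exact h3

/-- **equivalent diagonal forms have the same rank**: `|S(c)| = |S(c')|` (injective transfer maps both ways).
[cite: Rangarao1993, Appendix Thm A.3, p. 367] -/
theorem card_coeffSupport_eq (htwo : (2 : F) ≠ 0) (E : (ι → F) ≃ₗ[F] (ι → F))
    (hE : ∀ x, weightedSumSquares F c x = weightedSumSquares F c' (E x)) :
    Fintype.card (coeffSupport c) = Fintype.card (coeffSupport c') := by
  have hE' : ∀ x, weightedSumSquares F c' x = weightedSumSquares F c (E.symm x) := fun x => by
    rw [hE, LinearEquiv.apply_symm_apply]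
  have h1 := LinearMap.finrank_le_finrank_of_injective
    (transferMap_injective htwo (E : (ι → F) →ₗ[F] (ι → F)) hE)
  have h2 := LinearMap.finrank_le_finrank_of_injective
    (transferMap_injective htwo (E.symm : (ι → F) →ₗ[F] (ι → F)) hE')
  rw [Module.finrank_fintype_fun_eq_card, Module.finrank_fintype_fun_eq_card] at h1 h2
  exact le_antisymm h1 h2

/-- **the non-degenerate parts of equivalent diagonal forms are equivalent**: the transfer map is a linear isomorphism
`F^{S(c)} ≃ F^{S(c')}` with `f'_{S'} ∘ T = f_S` (`X/rad f ≅ X'/rad f'` isometrically).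
[cite: Rangarao1993, Appendix Thm A.3, p. 367] -/
def transferEquiv (htwo : (2 : F) ≠ 0) (E : (ι → F) ≃ₗ[F] (ι → F))
    (hE : ∀ x, weightedSumSquares F c x = weightedSumSquares F c' (E x)) :
    (coeffSupport c → F) ≃ₗ[F] (coeffSupport c' → F) :=
  (transferMap c c' (E : (ι → F) →ₗ[F] (ι → F))).linearEquivOfInjective
    (transferMap_injective htwo (E : (ι → F) →ₗ[F] (ι → F)) hE)
    (by rw [Module.finrank_fintype_fun_eq_card, Module.finrank_fintype_fun_eq_card, card_coeffSupport_eq htwo E hE])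

/-- unfolding. [cite: Rangarao1993, Appendix Thm A.3, p. 367] -/
theorem transferEquiv_apply (htwo : (2 : F) ≠ 0) (E : (ι → F) ≃ₗ[F] (ι → F))
    (hE : ∀ x, weightedSumSquares F c x = weightedSumSquares F c' (E x)) (x : coeffSupport c → F) :
    transferEquiv htwo E hE x = transferMap c c' (E : (ι → F) →ₗ[F] (ι → F)) x := rfl

/-- **every quadratic form on `F^ι` diagonalises in the given coordinates** (characteristic `≠ 2`; zeros allowed):
`f = (Σ cᵢ xᵢ²) ∘ A` with `A ∈ GL(F^ι)` (Mathlib's orthogonal basis, re-indexed by `ι`).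
[cite: Weil1964, Chap. II n° 25, p. 173] -/
theorem exists_weightedSumSquares_linearEquiv' [Invertible (2 : F)] (Q : QuadraticForm F (ι → F)) :
    ∃ (c : ι → F) (A : (ι → F) ≃ₗ[F] (ι → F)), ∀ x, Q x = weightedSumSquares F c (A x) := by
  obtain ⟨v, hv⟩ := LinearMap.BilinForm.exists_orthogonal_basis (QuadraticForm.associated_isSymm F Q)
  let σ : ι ≃ Fin (Module.finrank F (ι → F)) :=
    Fintype.equivFinOfCardEq (Module.finrank_fintype_fun_eq_card F).symm
  let v' : Module.Basis ι F (ι → F) := v.reindex σ.symm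
  have hv' : (QuadraticMap.associated (R := F) Q).IsOrthoᵢ v' := by
    intro i j hij
    simp only [v', Function.onFun, Module.Basis.reindex_apply, Equiv.symm_symm]
    exact hv (σ.injective.ne hij)
  refine ⟨fun i => Q (v' i), (Q.isometryEquivBasisRepr v').toLinearEquiv, fun x => ?_⟩
  rw [← QuadraticMap.basisRepr_eq_of_iIsOrtho Q v' hv']
  exact ((Q.isometryEquivBasisRepr v').map_app x).symm

end Algebra

/-! ## §2 The Weil index of a diagonal form with zeros; independence of the diagonalisation -/

section Defs

variable {F : Type*} [Field F] [ValuativeRel F] [TopologicalSpace F] [IsNonarchimedeanLocalField F]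
  {ι : Type*} [Fintype ι] (ψ : AddChar F Circle) [MeasurableSpace F] (μ : Measure F)

/-- **the Weil index of the diagonal form `Σ cᵢ xᵢ²` with ARBITRARY coefficients**: `Π_{i : cᵢ ≠ 0} γ(cᵢ xᵢ²)` — the Weil
index of its non-degenerate part `Σ_{cᵢ≠0} cᵢxᵢ²`, i.e. of the form induced on `X / rad`.
[cite: Rangarao1993, Appendix Thm A.3, p. 367] -/
def weilIndexDiag (c : ι → F) : ℂ := ∏ i : coeffSupport c, weilIndex ψ μ (c i)

/-- unfolding. [cite: Rangarao1993, Appendix Thm A.3, p. 367] -/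
theorem weilIndexDiag_def (c : ι → F) : weilIndexDiag ψ μ c = ∏ i : coeffSupport c, weilIndex ψ μ (c i) := rfl

/-- for non-zero coefficients `weilIndexDiag c = Πᵢ γ(cᵢ)`. [cite: Weil1964, Chap. II n° 25 Prop. 3, p. 173] -/
theorem weilIndexDiag_of_ne_zero {c : ι → F} (hc : ∀ i, c i ≠ 0) :
    weilIndexDiag ψ μ c = ∏ i, weilIndex ψ μ (c i) := by
  rw [weilIndexDiag]
  exact Fintype.prod_equiv (Equiv.subtypeUnivEquiv hc) _ _ fun i => rfl

/-- the zero form has index `1`. [cite: Rangarao1993, Appendix Thm A.3, p. 367] -/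
theorem weilIndexDiag_zero : weilIndexDiag ψ μ (0 : ι → F) = 1 := by
  rw [weilIndexDiag]
  haveI : IsEmpty (coeffSupport (0 : ι → F)) := ⟨fun i => i.2 rfl⟩
  exact Fintype.prod_empty _

/-- **the Weil index of an ARBITRARY quadratic form on `F^ι`** (characteristic `≠ 2`): the index `Π_{cᵢ≠0} γ(cᵢxᵢ²)` of the
non-degenerate part of SOME diagonalisation `f = (Σ cᵢxᵢ²) ∘ A` — by `weilIndexQF'_eq_weilIndexDiag` every diagonalisation
gives the same value. [cite: Rangarao1993, Appendix Thm A.3, p. 367] -/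
def weilIndexQF' [Invertible (2 : F)] (Q : QuadraticForm F (ι → F)) : ℂ :=
  weilIndexDiag ψ μ (Classical.choose (exists_weightedSumSquares_linearEquiv' Q))

end Defs

section Index

variable {F : Type*} [Field F] [ValuativeRel F] [TopologicalSpace F] [IsNonarchimedeanLocalField F]
variable {ι : Type*} [Fintype ι] [MeasurableSpace F] [BorelSpace F] (μ : Measure F) [μ.IsAddHaarMeasure]
  {ψ : AddChar F Circle} [Invertible (2 : F)]

/-- `weilIndexDiag` is the Weil index `weilIndexQF` of the non-degenerate part. [cite: Rangarao1993, Appendix Thm A.3, p. 367] -/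
theorem weilIndexDiag_eq_weilIndexQF (hψ : ψ.IsContinuousNontrivial) (c : ι → F) :
    weilIndexDiag ψ μ c = weilIndexQF ψ μ (weightedSumSquares F fun i : coeffSupport c => c i) := by
  rw [weilIndexDiag, weilIndexQF_weightedSumSquares μ hψ fun i : coeffSupport c => i.2]

/-- **INDEPENDENCE OF THE DIAGONALISATION**: if `Σ cᵢ xᵢ² = (Σ c'ⱼ xⱼ²) ∘ E` for some `E ∈ GL(F^ι)` (the two diagonal forms,
zeros allowed, are equivalent), then `Π_{cᵢ≠0} γ(cᵢ) = Π_{c'ⱼ≠0} γ(c'ⱼ)`: the non-degenerate parts are equivalent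
(`transferEquiv`), and after re-indexing `S(c) ≃ S(c')` this exhibits two diagonalisations of ONE non-degenerate form, to
which `weilIndexQF_eq_prod_weilIndex` applies ("`γ(f ∘ α) = γ(f)` for any automorphism `α`").
[cite: Rangarao1993, Appendix Thm A.2 (1) and Thm A.3, pp. 366–367] -/
theorem weilIndexDiag_eq_of_equiv (hψ : ψ.IsContinuousNontrivial) {c c' : ι → F}
    (E : (ι → F) ≃ₗ[F] (ι → F)) (hE : ∀ x, weightedSumSquares F c x = weightedSumSquares F c' (E x)) :
    weilIndexDiag ψ μ c = weilIndexDiag ψ μ c' := by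
  have htwo : (2 : F) ≠ 0 := Invertible.ne_zero 2
  -- re-index the support of `c'` by the support of `c`
  let σ : coeffSupport c ≃ coeffSupport c' := Fintype.equivOfCardEq (card_coeffSupport_eq htwo E hE)
  let R : (coeffSupport c' → F) ≃ₗ[F] (coeffSupport c → F) := LinearEquiv.funCongrLeft F F σ
  let T : (coeffSupport c → F) ≃ₗ[F] (coeffSupport c' → F) := transferEquiv htwo E hE
  have hR : ∀ (y : coeffSupport c' → F) (i : coeffSupport c), R y i = y (σ i) := fun y i => rfl
  -- the non-degenerate part of `c`, diagonalised through `T` then `R` with the coefficients `c' ∘ σ`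
  have hdiag : ∀ x : coeffSupport c → F, weightedSumSquares F (fun i : coeffSupport c => c i) x =
      weightedSumSquares F (fun i : coeffSupport c => c' (σ i)) ((T.trans R) x) := by
    intro x
    rw [← weightedSumSquares_transferMap (E : (ι → F) →ₗ[F] (ι → F)) hE x, ← transferEquiv_apply htwo E hE,
      LinearEquiv.trans_apply, weightedSumSquares_apply, weightedSumSquares_apply]
    simp only [hR]
    exact (Fintype.sum_equiv σ (fun i => c' (σ i) • (T x (σ i) * T x (σ i)))
      (fun j => c' j • (T x j * T x j)) fun i => rfl).symm
  have h1 := weilIndexQF_weightedSumSquares μ hψ (fun i : coeffSupport c => i.2)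
  have h2 := weilIndexQF_eq_prod_weilIndex μ hψ (fun i : coeffSupport c => (σ i).2) hdiag
  rw [weilIndexDiag, weilIndexDiag, ← h1, h2]
  exact Fintype.prod_equiv σ _ _ fun i => rfl

/-! ## §3 The Weil index of an arbitrary quadratic form on `F^ι` -/

/-- **`γ'(f) = Π_{cᵢ≠0} γ(cᵢ)` for EVERY diagonalisation** `f = (Σ cᵢxᵢ²) ∘ A`. [cite: Rangarao1993, Appendix Thm A.3, p. 367] -/
theorem weilIndexQF'_eq_weilIndexDiag (hψ : ψ.IsContinuousNontrivial) {Q : QuadraticForm F (ι → F)} {c : ι → F}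
    {A : (ι → F) ≃ₗ[F] (ι → F)} (hQ : ∀ x, Q x = weightedSumSquares F c (A x)) :
    weilIndexQF' ψ μ Q = weilIndexDiag ψ μ c := by
  obtain ⟨A₀, hA₀⟩ := Classical.choose_spec (exists_weightedSumSquares_linearEquiv' Q)
  -- `Σ c₀ᵢ yᵢ² = Q (A₀⁻¹ y) = Σ cᵢ ((A A₀⁻¹) y)ᵢ²`
  have hE : ∀ y, weightedSumSquares F (Classical.choose (exists_weightedSumSquares_linearEquiv' Q)) y =
      weightedSumSquares F c ((A₀.symm.trans A) y) := fun y => by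
    rw [LinearEquiv.trans_apply, ← hQ, hA₀, LinearEquiv.apply_symm_apply]
  exact weilIndexDiag_eq_of_equiv μ hψ (A₀.symm.trans A) hE

/-- **agreement with `weilIndexQF` on non-degenerate forms**. [cite: Weil1964, Chap. II n° 25, p. 173] -/
theorem weilIndexQF'_eq_weilIndexQF (hψ : ψ.IsContinuousNontrivial) {Q : QuadraticForm F (ι → F)}
    (hQ : (QuadraticMap.associated (R := F) Q).SeparatingLeft) : weilIndexQF' ψ μ Q = weilIndexQF ψ μ Q := by
  obtain ⟨c, A, hc, hQA⟩ := exists_weightedSumSquares_linearEquiv Q hQ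
  rw [weilIndexQF'_eq_weilIndexDiag μ hψ hQA, weilIndexDiag_of_ne_zero ψ μ hc, weilIndexQF_eq_prod_weilIndex μ hψ hc hQA]

/-- **`γ'(f ∘ B) = γ'(f)`** for every `B ∈ GL(F^ι)` — now for ARBITRARY (possibly degenerate) `f`.
[cite: Rangarao1993, Appendix Thm A.2 (1), p. 366] -/
theorem weilIndexQF'_comp_linearEquiv (hψ : ψ.IsContinuousNontrivial) (Q : QuadraticForm F (ι → F))
    (B : (ι → F) ≃ₗ[F] (ι → F)) : weilIndexQF' ψ μ (Q.comp (B : (ι → F) →ₗ[F] (ι → F))) = weilIndexQF' ψ μ Q := by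
  obtain ⟨c, A, hQA⟩ := exists_weightedSumSquares_linearEquiv' Q
  have hQB : ∀ x, Q.comp (B : (ι → F) →ₗ[F] (ι → F)) x = weightedSumSquares F c ((B.trans A) x) := fun x => by
    rw [QuadraticMap.comp_apply, LinearEquiv.trans_apply]
    exact hQA (B x)
  rw [weilIndexQF'_eq_weilIndexDiag μ hψ hQB, weilIndexQF'_eq_weilIndexDiag μ hψ hQA]

/-- **`|γ'(f)| = 1`**. [cite: Weil1964, Chap. II n° 24, p. 173] -/
theorem norm_weilIndexQF' (hψ : ψ.IsContinuousNontrivial) (Q : QuadraticForm F (ι → F)) : ‖weilIndexQF' ψ μ Q‖ = 1 := by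
  obtain ⟨c, A, hQA⟩ := exists_weightedSumSquares_linearEquiv' Q
  rw [weilIndexQF'_eq_weilIndexDiag μ hψ hQA, weilIndexDiag, norm_prod]
  exact Finset.prod_eq_one fun i _ => norm_weilIndex μ hψ i.2 (Invertible.ne_zero 2)

/-- the zero form has `γ' = 1`. [cite: Rangarao1993, Appendix Thm A.3, p. 367] -/
theorem weilIndexQF'_zero (hψ : ψ.IsContinuousNontrivial) : weilIndexQF' ψ μ (0 : QuadraticForm F (ι → F)) = 1 := by
  have h0 : ∀ x : ι → F, (0 : QuadraticForm F (ι → F)) x =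
      weightedSumSquares F (0 : ι → F) (LinearEquiv.refl F (ι → F) x) := fun x => by
    rw [QuadraticMap.zero_apply, weightedSumSquares_apply]
    simp
  rw [weilIndexQF'_eq_weilIndexDiag μ hψ h0, weilIndexDiag_zero]

/-- **the non-degenerate part of a direct sum with a zero form**: `γ'` of `f(x|_{ι₁}) + 0(x|_{ι₂})` on `F^{ι₁ ⊔ ι₂}` is
`γ'(f)` — adding radical directions does not change the index. [cite: Rangarao1993, Appendix Thm A.3, p. 367] -/
theorem weilIndexQF'_sum_zero {ι₁ ι₂ : Type*} [Fintype ι₁] [Fintype ι₂] (hψ : ψ.IsContinuousNontrivial)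
    {Q₁ : QuadraticForm F (ι₁ → F)} {Q : QuadraticForm F (ι₁ ⊕ ι₂ → F)}
    (hsum : ∀ x, Q x = Q₁ (fun i => x (Sum.inl i))) : weilIndexQF' ψ μ Q = weilIndexQF' ψ μ Q₁ := by
  obtain ⟨c₁, A₁, hQA₁⟩ := exists_weightedSumSquares_linearEquiv' Q₁
  -- block automorphism `A₁ ⊕ id`
  let S := LinearEquiv.sumArrowLequivProdArrow ι₁ ι₂ F F
  let A : (ι₁ ⊕ ι₂ → F) ≃ₗ[F] (ι₁ ⊕ ι₂ → F) := (S.trans (A₁.prodCongr (LinearEquiv.refl F (ι₂ → F)))).trans S.symm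
  have hA : ∀ x, A x = Sum.elim (A₁ fun i => x (Sum.inl i)) (fun j => x (Sum.inr j)) := by
    intro x
    funext k
    rcases k with i | j
    · simp only [A, S, LinearEquiv.trans_apply, LinearEquiv.prodCongr_apply, Sum.elim_inl,
        LinearEquiv.sumArrowLequivProdArrow_symm_apply_inl]
      rfl
    · simp only [A, S, LinearEquiv.trans_apply, LinearEquiv.prodCongr_apply, Sum.elim_inr,
        LinearEquiv.sumArrowLequivProdArrow_symm_apply_inr, LinearEquiv.refl_apply]
      rfl
  have hQA : ∀ x, Q x = weightedSumSquares F (Sum.elim c₁ (0 : ι₂ → F)) (A x) := by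
    intro x
    rw [hsum, hQA₁, hA, weightedSumSquares_apply, weightedSumSquares_apply, Fintype.sum_sum_type]
    simp only [Sum.elim_inl, Sum.elim_inr, Pi.zero_apply, zero_smul, Finset.sum_const_zero, add_zero]
  rw [weilIndexQF'_eq_weilIndexDiag μ hψ hQA, weilIndexQF'_eq_weilIndexDiag μ hψ hQA₁, weilIndexDiag, weilIndexDiag]
  -- supports: `S(Sum.elim c₁ 0) ≃ S(c₁)` via `Sum.inl`
  let e : coeffSupport c₁ ≃ coeffSupport (Sum.elim c₁ (0 : ι₂ → F)) :=
    { toFun := fun i => ⟨Sum.inl i.1, by simpa using i.2⟩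
      invFun := fun k => match k with
        | ⟨Sum.inl i, h⟩ => ⟨i, by simpa using h⟩
        | ⟨Sum.inr j, h⟩ => absurd (by simp) h
      left_inv := fun i => rfl
      right_inv := fun k => by
        rcases k with ⟨i | j, h⟩
        · rfl
        · exact absurd (by simp) h }
  exact (Fintype.prod_equiv e _ _ fun i => rfl).symm

/-- **`γ'(-f) = conj γ'(f)`** for arbitrary `f` (`χ ∘ (-f)` is the conjugate of `χ ∘ f`).
[cite: Rangarao1993, Appendix Thm A.2 (2), p. 366] -/
theorem weilIndexQF'_neg (hψ : ψ.IsContinuousNontrivial) (Q : QuadraticForm F (ι → F)) :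
    weilIndexQF' ψ μ (-Q) = (starRingEnd ℂ) (weilIndexQF' ψ μ Q) := by
  obtain ⟨c, A, hQA⟩ := exists_weightedSumSquares_linearEquiv' Q
  have hQn : ∀ x, (-Q) x = weightedSumSquares F (-c) (A x) := fun x => by
    rw [QuadraticMap.neg_apply, hQA, weightedSumSquares_apply, weightedSumSquares_apply, ← Finset.sum_neg_distrib]
    exact Finset.sum_congr rfl fun i _ => by simp [smul_eq_mul]
  rw [weilIndexQF'_eq_weilIndexDiag μ hψ hQn, weilIndexQF'_eq_weilIndexDiag μ hψ hQA, weilIndexDiag, weilIndexDiag,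
    map_prod]
  -- the supports of `c` and `-c` correspond
  let e : coeffSupport c ≃ coeffSupport (-c) :=
    { toFun := fun i => ⟨i.1, by simpa using i.2⟩
      invFun := fun i => ⟨i.1, by simpa using i.2⟩
      left_inv := fun _ => rfl
      right_inv := fun _ => rfl }
  exact (Fintype.prod_equiv e _ _ fun i => by
    simp only [Pi.neg_apply, e]
    exact (weilIndex_neg μ hψ i.2 (Invertible.ne_zero 2)).symm).symm

/-- **the Weil index of a form on an abstract space is basis-independent** — now for ARBITRARY (possibly degenerate)
forms: `γ'` of the coordinate expression `f.basisRepr b` (a form on `F^ι`) does not depend on the basis `b` of `V`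
(two coordinate expressions differ by an automorphism of `F^ι`). This is the form in which the index of a Leray
invariant (a quadratic form on an abstract finite-dimensional space) is taken.
[cite: Rangarao1993, Appendix Thm A.2 (1) and Thm A.3, pp. 366–367] -/
theorem weilIndexQF'_basisRepr_eq (hψ : ψ.IsContinuousNontrivial) {V : Type*} [AddCommGroup V] [Module F V]
    (Q : QuadraticForm F V) (b b' : Module.Basis ι F V) :
    weilIndexQF' ψ μ (Q.basisRepr b) = weilIndexQF' ψ μ (Q.basisRepr b') := by
  let E : (ι → F) ≃ₗ[F] (ι → F) := b'.equivFun.symm.trans b.equivFun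
  have hE : Q.basisRepr b' = (Q.basisRepr b).comp (E : (ι → F) →ₗ[F] (ι → F)) := by
    refine QuadraticMap.ext fun x => ?_
    simp only [QuadraticMap.basisRepr, QuadraticMap.comp_apply, E, LinearEquiv.coe_coe, LinearEquiv.trans_apply,
      LinearEquiv.symm_apply_apply]
  rw [hE, weilIndexQF'_comp_linearEquiv μ hψ (Q.basisRepr b) E]

/-- **`γ'` does not depend on the Haar measure**. [cite: Weil1964, Chap. II n° 24, p. 173] -/
theorem weilIndexQF'_eq_of_isAddHaarMeasure (μ' : Measure F) [μ'.IsAddHaarMeasure] (hψ : ψ.IsContinuousNontrivial)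
    (Q : QuadraticForm F (ι → F)) : weilIndexQF' ψ μ' Q = weilIndexQF' ψ μ Q := by
  obtain ⟨c, A, hQA⟩ := exists_weightedSumSquares_linearEquiv' Q
  rw [weilIndexQF'_eq_weilIndexDiag μ' hψ hQA, weilIndexQF'_eq_weilIndexDiag μ hψ hQA, weilIndexDiag, weilIndexDiag]
  exact Finset.prod_congr rfl fun i _ => weilIndex_eq_of_isAddHaarMeasure μ μ' hψ i.2 (Invertible.ne_zero 2)

/-- **orthogonal sums (Rao Thm A.2 (3) / Weil Prop. 3) for ARBITRARY forms**: if `f(x) = f₁(x|_{ι₁}) + f₂(x|_{ι₂})` on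
`F^{ι₁ ⊔ ι₂}` then `γ'(f) = γ'(f₁) γ'(f₂)` — no non-degeneracy needed. [cite: Rangarao1993, Appendix Thm A.2 (3), p. 366] -/
theorem weilIndexQF'_sum {ι₁ ι₂ : Type*} [Fintype ι₁] [Fintype ι₂] (hψ : ψ.IsContinuousNontrivial)
    {Q₁ : QuadraticForm F (ι₁ → F)} {Q₂ : QuadraticForm F (ι₂ → F)} {Q : QuadraticForm F (ι₁ ⊕ ι₂ → F)}
    (hsum : ∀ x, Q x = Q₁ (fun i => x (Sum.inl i)) + Q₂ (fun j => x (Sum.inr j))) :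
    weilIndexQF' ψ μ Q = weilIndexQF' ψ μ Q₁ * weilIndexQF' ψ μ Q₂ := by
  obtain ⟨c₁, A₁, hQA₁⟩ := exists_weightedSumSquares_linearEquiv' Q₁
  obtain ⟨c₂, A₂, hQA₂⟩ := exists_weightedSumSquares_linearEquiv' Q₂
  -- the block-diagonal automorphism `A₁ ⊕ A₂` of `F^{ι₁ ⊔ ι₂}`
  let S := LinearEquiv.sumArrowLequivProdArrow ι₁ ι₂ F F
  let A : (ι₁ ⊕ ι₂ → F) ≃ₗ[F] (ι₁ ⊕ ι₂ → F) := (S.trans (A₁.prodCongr A₂)).trans S.symm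
  have hA : ∀ x, A x = Sum.elim (A₁ fun i => x (Sum.inl i)) (A₂ fun j => x (Sum.inr j)) := by
    intro x
    funext k
    rcases k with i | j
    · simp only [A, S, LinearEquiv.trans_apply, LinearEquiv.prodCongr_apply, Sum.elim_inl,
        LinearEquiv.sumArrowLequivProdArrow_symm_apply_inl]
      rfl
    · simp only [A, S, LinearEquiv.trans_apply, LinearEquiv.prodCongr_apply, Sum.elim_inr,
        LinearEquiv.sumArrowLequivProdArrow_symm_apply_inr]
      rfl
  have hQA : ∀ x, Q x = weightedSumSquares F (Sum.elim c₁ c₂) (A x) := by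
    intro x
    rw [hsum, hQA₁, hQA₂, hA, weightedSumSquares_apply, weightedSumSquares_apply, weightedSumSquares_apply,
      Fintype.sum_sum_type]
    simp only [Sum.elim_inl, Sum.elim_inr]
  rw [weilIndexQF'_eq_weilIndexDiag μ hψ hQA, weilIndexQF'_eq_weilIndexDiag μ hψ hQA₁,
    weilIndexQF'_eq_weilIndexDiag μ hψ hQA₂, weilIndexDiag, weilIndexDiag, weilIndexDiag]
  -- supports: `S(Sum.elim c₁ c₂) ≃ S(c₁) ⊕ S(c₂)`
  let e : coeffSupport c₁ ⊕ coeffSupport c₂ ≃ coeffSupport (Sum.elim c₁ c₂) :=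
    { toFun := fun k => match k with
        | Sum.inl i => ⟨Sum.inl i.1, by simpa using i.2⟩
        | Sum.inr j => ⟨Sum.inr j.1, by simpa using j.2⟩
      invFun := fun k => match k with
        | ⟨Sum.inl i, h⟩ => Sum.inl ⟨i, by simpa using h⟩
        | ⟨Sum.inr j, h⟩ => Sum.inr ⟨j, by simpa using h⟩
      left_inv := fun k => by rcases k with i | j <;> rfl
      right_inv := fun k => by
        rcases k with ⟨i | j, h⟩ <;> rfl }
  rw [← Fintype.prod_equiv e (fun k => Sum.elim (fun i : coeffSupport c₁ => weilIndex ψ μ (c₁ i))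
      (fun j : coeffSupport c₂ => weilIndex ψ μ (c₂ j)) k) _ (fun k => by rcases k with i | j <;> rfl),
    Fintype.prod_sum_type]
  simp only [Sum.elim_inl, Sum.elim_inr]

end Index

end Literature.NumberTheory.Weil1964
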